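import Summits.CriticalPhenomena.PercolationContinuityZ3.Theorems.SahiMasterFamilyCoordPoly

/-!
# `E_k` along one coordinate, II: the polynomial peel identity and the `(k−2)`-shared coordinate detector

Unit `prim-master-conj` (crux anchor stmt-CriticalPhenomena-4575), gen 7.  Continues `SahiMasterFamilyCoordPoly` (`sahiEP (secPoly p e) k F` = the
polynomial `s ↦ E_k(μ_{p[e↦s]}; F)`).
* `sahiEP_peel`: the Lieb–Sahi recursion PEELED AT ANY SLOT holds for the fibre polynomials themselves (both sides agree on the infinite set
  `(0,1)`), so coefficients can be computed by peeling at `e`-free slots.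
* `coeff_sahiEP_one_free`: with ONE `e`-free slot `i₀` (`k = n+2`), `[s^{n+1}] = (−1)^n · freeDetector(F off i₀; F i₀)`,
  `freeDetector(G; f) = Σ_l XΔ(G_l f) ∏_{j≠l} XΔ(G_j) − X₀(f) ∏_j XΔ(G_j)` (`XΔ = X₁ − X₀ =: secDelta`) — the value behind
  `detector_of_forall_sahiE_update_eq_zero`.
* `coeff_sahiEP_two_free` and **`detector₂_of_forall_sahiE_update_eq_zero`**: with TWO `e`-free slots (a coordinate on which exactly `k − 2`
  members depend), `[s^{k−2}]` is `(−1)^{n} · [Σ_l freeDetector(shrunk families) − X₀ · freeDetector]` (`k = n+3`), and it vanishes when `E_k ≡ 0`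
  on the fibre — the `r_e = k − 2` DETECTOR, uniformly in `k` (for `k = 4` the `r_e = 2` case: with (T-a) (`r_e = 4`), the `(k−1)`-shared detector
  (`r_e = 3`) and private gluing (`r_e = 1`) every sharing pattern of a coordinate of a quadruple now has its identity).
Axioms standard. [this work]
-/

noncomputable section

open scoped Classical

namespace Summit.CriticalPhenomena.PercolationContinuityZ3.Theorems

open Finset Function Polynomial
open Literature.Combinatorics.Sahi2008
open Literature.Probability.LatticeModels.Kahn2022 (Affects)
open Literature.Probability.Percolation.DecisionTree (ind ind_of_mem ind_of_not_mem)

variable {ι : Type*} [Fintype ι]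

/-! ### Section differences and the one-free detector expression -/

/-- `XΔ(h) = X₁(h) − X₀(h)`: the difference of the two section moments off `e` (for `h = 1_A`, `A` increasing: the mass of the pivotal set
`Piv_e A` off `e`). [this work] -/
def secDelta (p : ι → unitInterval) (e : ι) (h : Set ι → ℝ) : ℝ := secEx p e h true - secEx p e h false

/-- The `s`-coefficient of the moment map is `XΔ`. [this work] -/
theorem coeff_secPoly_one' (p : ι → unitInterval) (e : ι) (h : Set ι → ℝ) : (secPoly p e h).coeff 1 = secDelta p e h :=
  coeff_secPoly_one p e h

/-- **The one-free detector expression** `Σ_l XΔ(G_l · f) ∏_{j ≠ l} XΔ(G_j) − X₀(f) ∏_j XΔ(G_j)`. [this work] -/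
def freeDetector (p : ι → unitInterval) (e : ι) {m : ℕ} (G : Fin m → Set ι → ℝ) (f : Set ι → ℝ) : ℝ :=
  (∑ l : Fin m, secDelta p e (G l * f) * ∏ j ∈ univ.erase l, secDelta p e (G j)) - secEx p e f false * ∏ j, secDelta p e (G j)

/-- A function ignoring `e` has equal section moments. [this work] -/
theorem secEx_true_eq_false_of_ignores (p : ι → unitInterval) (e : ι) {f : Set ι → ℝ} (hf : ∀ ω, f (insert e ω) = f ω) :
    secEx p e f true = secEx p e f false := by
  simp only [secEx, Bool.false_eq_true, if_false, if_true]
  exact sum_congr rfl fun ω _ => by rw [hf ω]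

omit [Fintype ι] in
/-- Products of functions ignoring `e` ignore `e`. [folklore] -/
theorem mul_ignores {e : ι} {f g : Set ι → ℝ} (hf : ∀ ω, f (insert e ω) = f ω) (hg : ∀ ω, g (insert e ω) = g ω) :
    ∀ ω, (f * g) (insert e ω) = (f * g) ω := fun ω => by
  simp only [Pi.mul_apply, hf ω, hg ω]

/-! ### The peel identity for fibre polynomials -/

/-- **The recursion peeled at any slot, as an identity of fibre polynomials.** [this work] -/
theorem sahiEP_peel (p : ι → unitInterval) (e : ι) {n : ℕ} (F : Fin (n + 2) → Set ι → ℝ) (i₀ : Fin (n + 2)) :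
    sahiEP (secPoly p e) (n + 2) F =
      (∑ l : Fin (n + 1), sahiEP (secPoly p e) (n + 1)
          (update (fun j => F (i₀.succAbove j)) l (F (i₀.succAbove l) * F i₀))) -
        sahiEP (secPoly p e) (n + 1) (fun j => F (i₀.succAbove j)) * secPoly p e (F i₀) := by
  -- both sides evaluate to `E_{n+2}(μ_{p[e↦s]}; F)` for every `s ∈ (0,1)`
  refine sub_eq_zero.1 (Polynomial.eq_zero_of_infinite_isRoot _ ((Set.Ioo_infinite (zero_lt_one' ℝ)).mono fun x hx => ?_))
  set s : unitInterval := ⟨x, hx.1.le, hx.2.le⟩ with hs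
  have hx' : x = (s : ℝ) := rfl
  rw [Set.mem_setOf_eq, IsRoot.def, hx', eval_sub, eval_sub, eval_mul, eval_finsetSum, eval_secPoly,
    eval_sahiEP (secPoly p e) _ _ (fun h => eval_secPoly p e s h) (n + 2) F,
    eval_sahiEP (secPoly p e) _ _ (fun h => eval_secPoly p e s h) (n + 1), sahiE_peel _ n F i₀]
  simp_rw [eval_sahiEP (secPoly p e) _ _ (fun h => eval_secPoly p e s h) (n + 1)]
  ring

/-! ### One `e`-free slot -/

/-- The moment map of a function ignoring `e` is constant. [this work] -/
theorem secPoly_eq_C_of_ignores (p : ι → unitInterval) (e : ι) {f : Set ι → ℝ} (hf : ∀ ω, f (insert e ω) = f ω) :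
    secPoly p e f = C (secEx p e f false) := by
  rw [secPoly, secEx_true_eq_false_of_ignores p e hf, sub_self, C_0, zero_mul, add_zero]

/-- **The `s^{n+1}`-coefficient with one `e`-free slot** `i₀` (`k = n + 2` slots): `(−1)^n · freeDetector(F off i₀; F i₀)`. [this work] -/
theorem coeff_sahiEP_one_free (p : ι → unitInterval) (e : ι) {n : ℕ} (F : Fin (n + 2) → Set ι → ℝ) (i₀ : Fin (n + 2))
    (hfree : ∀ ω, F i₀ (insert e ω) = F i₀ ω) :
    (sahiEP (secPoly p e) (n + 2) F).coeff (n + 1) = (-1) ^ n * freeDetector p e (fun j => F (i₀.succAbove j)) (F i₀) := by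
  have hM : ∀ h, (secPoly p e h).natDegree ≤ 1 := natDegree_secPoly_le p e
  set G : Fin (n + 1) → Set ι → ℝ := fun j => F (i₀.succAbove j) with hG
  rw [sahiEP_peel p e F i₀, coeff_sub, finsetSum_coeff, secPoly_eq_C_of_ignores p e hfree, coeff_mul_C,
    coeff_sahiEP_top (secPoly p e) hM n G, freeDetector, mul_sub, mul_sum]
  congr 1
  · refine sum_congr rfl fun l _ => ?_
    rw [coeff_sahiEP_top (secPoly p e) hM n]
    have hupd : (fun j => (secPoly p e (update G l (G l * F i₀) j)).coeff 1) =
        update (fun j => (secPoly p e (G j)).coeff 1) l ((secPoly p e (G l * F i₀)).coeff 1) := by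
      funext j; exact apply_update (fun _ g => (secPoly p e g).coeff 1) G l (G l * F i₀) j
    rw [hupd, prod_update_of_mem (mem_univ l), sdiff_singleton_eq_erase]
    simp only [coeff_secPoly_one']
  · simp only [coeff_secPoly_one']
    ring

/-! ### Two `e`-free slots: the `(k−2)`-shared detector -/

/-- **The `s^{n+1}`-coefficient with two `e`-free slots** (`k = n + 3` slots; free slots `i₀` and `i₀.succAbove i₁`); `G := F` off `i₀`:
`(−1)^n · [Σ_l freeDetector(G[l ↦ G_l · F_{i₀}] off i₁; its i₁-entry) − X₀(F_{i₀}) · freeDetector(G off i₁; G_{i₁})]`. [this work] -/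
theorem coeff_sahiEP_two_free (p : ι → unitInterval) (e : ι) {n : ℕ} (F : Fin (n + 3) → Set ι → ℝ) (i₀ : Fin (n + 3)) (i₁ : Fin (n + 2))
    (hfree₀ : ∀ ω, F i₀ (insert e ω) = F i₀ ω) (hfree₁ : ∀ ω, F (i₀.succAbove i₁) (insert e ω) = F (i₀.succAbove i₁) ω) :
    (sahiEP (secPoly p e) (n + 3) F).coeff (n + 1) =
      (-1) ^ n * ((∑ l : Fin (n + 2),
          freeDetector p e (fun j => update (fun j => F (i₀.succAbove j)) l (F (i₀.succAbove l) * F i₀) (i₁.succAbove j))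
            (update (fun j => F (i₀.succAbove j)) l (F (i₀.succAbove l) * F i₀) i₁)) -
        secEx p e (F i₀) false * freeDetector p e (fun j => F (i₀.succAbove (i₁.succAbove j))) (F (i₀.succAbove i₁))) := by
  set G : Fin (n + 2) → Set ι → ℝ := fun j => F (i₀.succAbove j) with hG
  -- the shrunk families keep `i₁` free
  have hfreeU : ∀ l : Fin (n + 2), ∀ ω, update G l (G l * F i₀) i₁ (insert e ω) = update G l (G l * F i₀) i₁ ω := by
    intro l
    by_cases hl : i₁ = l
    · subst hl; rw [update_self]; exact mul_ignores hfree₁ hfree₀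
    · rw [update_of_ne hl]; exact hfree₁
  rw [sahiEP_peel p e F i₀, coeff_sub, finsetSum_coeff, secPoly_eq_C_of_ignores p e hfree₀, coeff_mul_C,
    coeff_sahiEP_one_free p e G i₁ hfree₁, mul_sub, mul_sum]
  congr 1
  · exact sum_congr rfl fun l _ => coeff_sahiEP_one_free p e _ i₁ (hfreeU l)
  · ring

/-- **The `(k−2)`-shared coordinate detector**: if two slots `i₀`, `i₀.succAbove i₁` ignore `e` and `E_{n+3}(μ_{p[e↦s]}; F) = 0` for all
`s ∈ (0,1)`, then `Σ_l freeDetector(G[l ↦ G_l F_{i₀}] off i₁; ·) = X₀(F_{i₀}) · freeDetector(G off i₁; G_{i₁})` (`G := F` off `i₀`). [this work] -/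
theorem detector₂_of_forall_sahiE_update_eq_zero (p : ι → unitInterval) (e : ι) {n : ℕ} (F : Fin (n + 3) → Set ι → ℝ)
    (i₀ : Fin (n + 3)) (i₁ : Fin (n + 2))
    (hfree₀ : ∀ ω, F i₀ (insert e ω) = F i₀ ω) (hfree₁ : ∀ ω, F (i₀.succAbove i₁) (insert e ω) = F (i₀.succAbove i₁) ω)
    (h : ∀ s : unitInterval, (s : ℝ) ∈ Set.Ioo (0 : ℝ) 1 → sahiE (bernoulliWeight (update p e s)) (n + 3) F = 0) :
    (∑ l : Fin (n + 2),
        freeDetector p e (fun j => update (fun j => F (i₀.succAbove j)) l (F (i₀.succAbove l) * F i₀) (i₁.succAbove j))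
          (update (fun j => F (i₀.succAbove j)) l (F (i₀.succAbove l) * F i₀) i₁)) =
      secEx p e (F i₀) false * freeDetector p e (fun j => F (i₀.succAbove (i₁.succAbove j))) (F (i₀.succAbove i₁)) := by
  have hc := coeff_sahiEP_two_free p e F i₀ i₁ hfree₀ hfree₁
  rw [sahiEP_eq_zero_of_forall p e (n + 3) F h, coeff_zero] at hc
  have h1 : ((-1 : ℝ) ^ n) ≠ 0 := pow_ne_zero _ (by norm_num)
  exact sub_eq_zero.1 ((mul_eq_zero.1 hc.symm).resolve_left h1)

/-- **The `(k−2)`-shared detector for events**: `k = n+3` increasing events, `U i₀` and `U (i₀.succAbove i₁)` not depending on `e`, and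
`E_k ≡ 0` on the fibre `p[e ↦ ·]`; then the detector identity of `detector₂_of_forall_sahiE_update_eq_zero` holds for the indicator family.
[this work] -/
theorem detector₂_ind_of_forall_sahiE_update_eq_zero (p : ι → unitInterval) (e : ι) {n : ℕ} (U : Fin (n + 3) → Set (Set ι))
    (hU : ∀ j, IsUpperSet (U j)) (i₀ : Fin (n + 3)) (i₁ : Fin (n + 2)) (he₀ : ¬ Affects (U i₀) e)
    (he₁ : ¬ Affects (U (i₀.succAbove i₁)) e)
    (h : ∀ s : unitInterval, (s : ℝ) ∈ Set.Ioo (0 : ℝ) 1 → sahiE (bernoulliWeight (update p e s)) (n + 3) (fun j => ind (U j)) = 0) :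
    (∑ l : Fin (n + 2),
        freeDetector p e
          (fun j => update (fun j => ind (U (i₀.succAbove j))) l (ind (U (i₀.succAbove l)) * ind (U i₀)) (i₁.succAbove j))
          (update (fun j => ind (U (i₀.succAbove j))) l (ind (U (i₀.succAbove l)) * ind (U i₀)) i₁)) =
      secEx p e (ind (U i₀)) false *
        freeDetector p e (fun j => ind (U (i₀.succAbove (i₁.succAbove j)))) (ind (U (i₀.succAbove i₁))) := by
  -- increasing events not affected by `e` ignore `e` (cf. `SahiComb.ind_insert_of_not_affects`)
  have hign : ∀ {X : Set (Set ι)}, IsUpperSet X → ¬ Affects X e → ∀ ω, ind X (insert e ω) = ind X ω := by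
    intro X hX he ω
    by_cases hω : ω ∈ X
    · rw [ind_of_mem hω, ind_of_mem (hX (Set.subset_insert e ω) hω)]
    · rw [ind_of_not_mem hω, ind_of_not_mem fun h' => he ⟨ω, hω, h'⟩]
  exact detector₂_of_forall_sahiE_update_eq_zero p e (fun j => ind (U j)) i₀ i₁ (hign (hU i₀) he₀) (hign (hU _) he₁) h

end Summit.CriticalPhenomena.PercolationContinuityZ3.Theorems
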